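import Mathlib
import Literature.Computability.AlgebraicComplexity.ArithCircuitVars
import Summits.ValiantsHypothesis.ValiantsHypothesis.Theorems.BarrierLeverNaturalProofsAgainstAllLinearSizesOfCountSize
import Summits.ValiantsHypothesis.ValiantsHypothesis.Theorems.BarrierLeverDefinableEquationsBalancedStrengthThin
import Summits.ValiantsHypothesis.ValiantsHypothesis.Theorems.BarrierLeverDefinableEquationsDegreeWindow
import HarnessLib

/-!
# Crux `BarrierLever.DefinableEquations` (stmt-8745) ⟺ `SingleSizeEquations` (stmt-8749) —
# the degree window, RUNG ONE: cubic parts of polynomials of size `< (n-1)/2` are CONES, killed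
# by an explicit degree-`n` window determinant (val-np-p5 g22)

The degree-window axis (`…DegreeWindow*.lean`) charts explicit equations in the degree-`d`
coefficients alone for polynomials of circuit size `≤ s`, the door to the crux sitting at
`s = (d+2)² n^b`.  This file is the axis's bottom rung, for the record: a fan-in-two circuit of
size `s` reads at most `2s + 1` variables (tree `card_vars_le_two_mul_complexity_add_one`), so for
`2s + 1 < n` the polynomial misses a variable `x_j`, every cubic coefficient `c(x_j x_k²)` vanishes,
and the `n × n` WINDOW DETERMINANT `det (c(x_i x_k²))_{i,k}` (with `c(x_i x_i²) = c(x_i³)`) — a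
nonzero polynomial (value `1` at the Fermat cubic `Σ x_i³`) of degree `≤ n` and size `≤ 8(n+1)^7`
(Berkowitz) in the `C(n+2,3)` cubic window variables — vanishes.  Pulled back along the window
inclusion it is an algebraically natural proof with `q = 0` against `{f : L(f) ≤ s}` for every
`s < (n-1)/2`, of level `a` as soon as `8(n+1)^7 ≤ C(2n,n)^a` (level `1` eventually).

* §1 the cone monomials `x_i x_k²`: degree `3`, the row variable occurs, Fermat coefficients;
* §2 `eval_windowDet_eq_zero_of_notMem_vars`, `exists_notMem_vars_of_complexity_lt`,
  `eval_windowDet_fermat` (value `1`), size / degree of the determinant;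
* §3 **`exists_coneEquation`** (the rung, window form), **`isNaturalProof_cones`** (FSV form at
  level `a`), `cones_level_one_eventually`, `isNaturalProof_cones_eventually` (level `1`).

Honest placement: this is the TRIVIAL end of the size axis (`s < n/2`; the crux's classes have
`s = n^b ≥ n`), recorded so that the axis has a kernel rung below the walls of
`…DegreeWindowSparsity` (no window witness of degree `≤ t` once `s ≥ 4t`) and the door at
`s = 25 n²` (`b = 2`).  Nothing here bears on 8745/8749's verdict (OPEN at `b = 2`,
Chatterjee–Tengse 2023 §1.3 dir. 2), on crux 14610, or on `VP ≠ VNP`, which is NOT proved.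
No definitions, no named facts; standard axioms.

References: Bürgisser 2000, Def. 2.1 / Rem. 2.2 (size, variables read); Forbes–Shpilka–Volk 2018,
Def. 1; Berkowitz 1984 (determinant circuits, via the tree's `complexity_detPoly_le`).
-/

set_option linter.dupNamespace false

noncomputable section

namespace Summit.ValiantsHypothesis.ValiantsHypothesis.Theorems.BarrierLeverDefinableEquations

open MvPolynomial
open Literature.Computability.AlgebraicComplexity Literature.Barriers.ValiantsHypothesis
open scoped BigOperators

namespace DegreeWindow

/-! ## §1 The cone monomials `x_i x_k²` -/

/-- `x_i x_k²` has degree `3`. [folklore] -/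
theorem degree_single_add_single {n : ℕ} (i k : Fin n) :
    (Finsupp.single i 1 + Finsupp.single k 2 : Fin n →₀ ℕ).degree = 3 := by
  rw [map_add, Finsupp.degree_single, Finsupp.degree_single]

/-- `x_i x_k²` is a cubic window coordinate. [cite: GrochowKumarSaksSaraf2017, §2.1] -/
theorem single_add_single_mem_homMonomials {n : ℕ} (i k : Fin n) :
    (Finsupp.single i 1 + Finsupp.single k 2 : Fin n →₀ ℕ) ∈ GKSS2017.homMonomials n 3 :=
  degree_single_add_single i k

/-- The row variable `x_i` occurs in `x_i x_k²`. [folklore] -/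
theorem mem_support_single_add_single {n : ℕ} (i k : Fin n) :
    i ∈ (Finsupp.single i 1 + Finsupp.single k 2 : Fin n →₀ ℕ).support := by
  rw [Finsupp.mem_support_iff, Finsupp.add_apply, Finsupp.single_eq_same]
  omega

/-- `x_j³ = x_i x_k²` iff `j = i = k`. [folklore] -/
theorem single_three_eq_iff {n : ℕ} (i k j : Fin n) :
    (Finsupp.single j 3 : Fin n →₀ ℕ) = Finsupp.single i 1 + Finsupp.single k 2 ↔ j = i ∧ i = k := by
  constructor
  · intro h
    by_cases hji : j = i
    · subst hji
      refine ⟨rfl, ?_⟩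
      by_contra hjk
      have hj := DFunLike.congr_fun h j
      rw [Finsupp.add_apply, Finsupp.single_eq_same, Finsupp.single_eq_same,
        Finsupp.single_apply, if_neg (fun hkj => hjk hkj.symm)] at hj
      omega
    · exfalso
      have hi := DFunLike.congr_fun h i
      rw [Finsupp.add_apply, Finsupp.single_eq_same, Finsupp.single_apply, if_neg hji,
        Finsupp.single_apply] at hi
      generalize (if k = i then (2 : ℕ) else 0) = t at hi
      omega
  · rintro ⟨rfl, rfl⟩
    rw [← Finsupp.single_add]

/-- Coefficient of `x_i x_k²` in the Fermat cubic `Σ_j x_j³`: `1` on the diagonal, `0` off it.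
[folklore] -/
theorem coeff_single_add_single_fermat {n : ℕ} (i k : Fin n) :
    coeff (Finsupp.single i 1 + Finsupp.single k 2) (∑ j : Fin n, (X j : MvPolynomial (Fin n) ℂ) ^ 3) =
      if i = k then 1 else 0 := by
  classical
  rw [coeff_sum]
  simp_rw [X_pow_eq_monomial, coeff_monomial, single_three_eq_iff]
  by_cases hik : i = k
  · subst hik
    rw [if_pos rfl]
    simp
  · rw [if_neg hik]
    exact Finset.sum_eq_zero fun j _ => if_neg fun h => hik h.2

/-! ## §2 The window determinant `det (c(x_i x_k²))_{i,k}` -/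

/-- **A missing variable kills a row.** If `x_j` does not occur in `g`, the window determinant
vanishes at `coeff₃(g)` (row `j` of the numerical matrix is zero). [folklore] -/
theorem eval_windowDet_eq_zero_of_notMem_vars {n : ℕ} {g : MvPolynomial (Fin n) ℂ} {j : Fin n}
    (hj : j ∉ g.vars) :
    eval (coeffVector (GKSS2017.homMonomials n 3) g)
      (Matrix.of fun i k : Fin n =>
        (X ⟨Finsupp.single i 1 + Finsupp.single k 2, single_add_single_mem_homMonomials i k⟩ :
          MvPolynomial (GKSS2017.homMonomials n 3) ℂ)).det = 0 := by
  rw [RingHom.map_det]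
  refine Matrix.det_eq_zero_of_row_eq_zero j fun k => ?_
  rw [RingHom.mapMatrix_apply, Matrix.map_apply, Matrix.of_apply, eval_X, coeffVector_apply]
  by_contra hne
  exact hj ((mem_vars_iff_mem_support j).mpr ⟨_, mem_support_iff.mpr hne, mem_support_single_add_single j k⟩)

/-- A polynomial of size `s` with `2s + 1 < n` misses one of the `n` variables.
[cite: Burgisser2000, Def. 2.1 and Rem. 2.2] -/
theorem exists_notMem_vars_of_complexity_lt {n : ℕ} {g : MvPolynomial (Fin n) ℂ}
    (h : 2 * complexity g + 1 < n) : ∃ j : Fin n, j ∉ g.vars := by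
  by_contra hall
  push Not at hall
  have huniv : g.vars = Finset.univ := Finset.eq_univ_of_forall hall
  have hcard := ArithCircuit.card_vars_le_two_mul_complexity_add_one g
  rw [huniv, Finset.card_univ, Fintype.card_fin] at hcard
  omega

/-- **The window determinant is `1` at the Fermat cubic** (the numerical matrix is the identity);
in particular it is a nonzero polynomial. [folklore] -/
theorem eval_windowDet_fermat (n : ℕ) :
    eval (coeffVector (GKSS2017.homMonomials n 3) (∑ j : Fin n, (X j : MvPolynomial (Fin n) ℂ) ^ 3))
      (Matrix.of fun i k : Fin n =>
        (X ⟨Finsupp.single i 1 + Finsupp.single k 2, single_add_single_mem_homMonomials i k⟩ :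
          MvPolynomial (GKSS2017.homMonomials n 3) ℂ)).det = 1 := by
  rw [RingHom.map_det]
  have h1 : (eval (coeffVector (GKSS2017.homMonomials n 3)
      (∑ j : Fin n, (X j : MvPolynomial (Fin n) ℂ) ^ 3))).mapMatrix
      (Matrix.of fun i k : Fin n =>
        (X ⟨Finsupp.single i 1 + Finsupp.single k 2, single_add_single_mem_homMonomials i k⟩ :
          MvPolynomial (GKSS2017.homMonomials n 3) ℂ)) = 1 := by
    ext i k
    rw [RingHom.mapMatrix_apply, Matrix.map_apply, Matrix.of_apply, eval_X, coeffVector_apply,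
      Matrix.one_apply]
    exact coeff_single_add_single_fermat i k
  rw [h1, Matrix.det_one]

/-- The window determinant is a NONZERO polynomial. [folklore] -/
theorem windowDet_ne_zero (n : ℕ) :
    (Matrix.of fun i k : Fin n =>
        (X ⟨Finsupp.single i 1 + Finsupp.single k 2, single_add_single_mem_homMonomials i k⟩ :
          MvPolynomial (GKSS2017.homMonomials n 3) ℂ)).det ≠ 0 := by
  intro h
  have h1 := eval_windowDet_fermat n
  rw [h, map_zero] at h1
  exact zero_ne_one h1

/-- Size of the window determinant: `≤ 8(n+1)^7` (Berkowitz, tree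
`NaturalProofsAgainstAllLinearSizes.complexity_det_le`). [folklore] -/
theorem complexity_windowDet_le (n : ℕ) :
    complexity (Matrix.of fun i k : Fin n =>
        (X ⟨Finsupp.single i 1 + Finsupp.single k 2, single_add_single_mem_homMonomials i k⟩ :
          MvPolynomial (GKSS2017.homMonomials n 3) ℂ)).det ≤ 8 * (n + 1) ^ 7 := by
  have h := BarrierLever.NaturalProofsAgainstAllLinearSizes.complexity_det_le
    (Matrix.of fun i k : Fin n =>
        (X ⟨Finsupp.single i 1 + Finsupp.single k 2, single_add_single_mem_homMonomials i k⟩ :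
          MvPolynomial (GKSS2017.homMonomials n 3) ℂ)) 0
    (fun i k => by rw [Matrix.of_apply, complexity_X_holds])
  simpa [Fintype.card_fin] using h

/-- Degree of the window determinant: `≤ n`. [folklore] -/
theorem totalDegree_windowDet_le (n : ℕ) :
    (Matrix.of fun i k : Fin n =>
        (X ⟨Finsupp.single i 1 + Finsupp.single k 2, single_add_single_mem_homMonomials i k⟩ :
          MvPolynomial (GKSS2017.homMonomials n 3) ℂ)).det.totalDegree ≤ n := by
  have h := BarrierLever.NaturalProofsAgainstAllLinearSizes.totalDegree_det_le_card
    (Matrix.of fun i k : Fin n =>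
        (X ⟨Finsupp.single i 1 + Finsupp.single k 2, single_add_single_mem_homMonomials i k⟩ :
          MvPolynomial (GKSS2017.homMonomials n 3) ℂ))
    (fun i k => by rw [Matrix.of_apply, totalDegree_X])
  simpa [Fintype.card_fin] using h

/-! ## §3 Rung one of the size axis -/

/-- **RUNG ONE (cones).** For every `n` there is an EXPLICIT nonzero polynomial in the `C(n+2,3)`
cubic window variables — the window determinant `det (c(x_i x_k²))` — of degree `≤ n` and size
`≤ 8(n+1)^7`, vanishing at `coeff₃(g)` for every polynomial `g` of circuit size `s` with
`2s + 1 < n` (such a `g` misses a variable). [cite: Burgisser2000, Def. 2.1 and Rem. 2.2] -/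
theorem exists_coneEquation (n : ℕ) :
    ∃ D : MvPolynomial (GKSS2017.homMonomials n 3) ℂ, D ≠ 0 ∧ D.totalDegree ≤ n ∧
      complexity D ≤ 8 * (n + 1) ^ 7 ∧
      ∀ g : MvPolynomial (Fin n) ℂ, 2 * complexity g + 1 < n →
        eval (coeffVector (GKSS2017.homMonomials n 3) g) D = 0 := by
  refine ⟨_, windowDet_ne_zero n, totalDegree_windowDet_le n, complexity_windowDet_le n,
    fun g hg => ?_⟩
  obtain ⟨j, hj⟩ := exists_notMem_vars_of_complexity_lt hg
  exact eval_windowDet_eq_zero_of_notMem_vars hj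

/-- **Rung one in FSV's frame.** For `n ≥ 3`, `2s + 1 < n` and a level `a` with
`8(n+1)^7 ≤ C(2n,n)^a`, the pulled-back window determinant is an algebraically natural proof with
`q = 0` Boolean variables against the class `{f : L(f) ≤ s}` from `Distinguishers ℂ n a`.
[cite: ForbesShpilkaVolk2018, Def. 1] -/
theorem isNaturalProof_cones {n s a : ℕ} (hn : 3 ≤ n) (hs : 2 * s + 1 < n)
    (ha : 8 * (n + 1) ^ 7 ≤ (Nat.choose (2 * n) n) ^ a) :
    ∃ D : MvPolynomial (degLEMonomials n) ℂ,
      IsNaturalProof (degLEMonomials n) {f : MvPolynomial (Fin n) ℂ | complexity f ≤ s}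
        (Distinguishers ℂ n a) D := by
  obtain ⟨D, hD0, hdeg, hc, hvan⟩ := exists_coneEquation n
  refine ⟨rename (Set.inclusion (homMonomials_subset_degLE hn)) D,
    ⟨(complexity_rename_inclusion_le hn D).trans (hc.trans ha),
      (totalDegree_rename_inclusion_le hn D).trans (hdeg.trans (le_trans ?_ ha))⟩,
    rename_inclusion_ne_zero hn hD0, fun f hf => ?_⟩
  · calc n ≤ n + 1 := Nat.le_succ n
      _ ≤ (n + 1) ^ 7 := Nat.le_self_pow (by norm_num) _
      _ ≤ 8 * (n + 1) ^ 7 := Nat.le_mul_of_pos_left _ (by norm_num)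
  · rw [eval_rename_inclusion hn]
    exact hvan f (by have := hf.out; omega)

/-- Level bookkeeping: `8(n+1)^7 ≤ C(2n,n)` eventually (`4^n < n C(2n,n)` for `n ≥ 4` and
`1024 n^8 < 2^n` eventually). [folklore] -/
theorem cones_level_one_eventually : ∃ n₀ : ℕ, ∀ n ≥ n₀, 8 * (n + 1) ^ 7 ≤ Nat.choose (2 * n) n := by
  obtain ⟨m₀, hm₀⟩ := BalancedStrength.eventually_mul_pow_lt_two_pow 8 1024
  refine ⟨max m₀ 4, fun n hn => ?_⟩
  have hn4 : 4 ≤ n := le_of_max_le_right hn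
  have h2 : 1024 * n ^ 8 < 2 ^ n := hm₀ n (le_of_max_le_left hn)
  have hcb : 4 ^ n < n * Nat.choose (2 * n) n := by
    rw [← Nat.centralBinom_eq_two_mul_choose]
    exact Nat.four_pow_lt_mul_centralBinom n hn4
  -- `8 (n+1)^7 · n ≤ 1024 n^8 < 2^n ≤ 4^n < n · C(2n,n)`
  have h3 : 8 * (n + 1) ^ 7 * n ≤ 1024 * n ^ 8 := by
    have h4 : n + 1 ≤ 2 * n := by omega
    calc 8 * (n + 1) ^ 7 * n ≤ 8 * (2 * n) ^ 7 * n := by gcongr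
      _ = 1024 * n ^ 8 := by ring
  have h6 : 2 ^ n ≤ 4 ^ n := Nat.pow_le_pow_left (by norm_num) n
  have h7 : 8 * (n + 1) ^ 7 * n ≤ n * Nat.choose (2 * n) n := by omega
  rw [mul_comm n (Nat.choose (2 * n) n)] at h7
  exact Nat.le_of_mul_le_mul_right h7 (by omega)

/-- **Rung one, level `1`, eventually in `n`**: for all large `n` and every `s < (n-1)/2` there is
a level-`1` algebraically natural proof (`q = 0`) against `{f : L(f) ≤ s}` — the window
determinant of the cones. [cite: ForbesShpilkaVolk2018, Def. 1] -/
theorem isNaturalProof_cones_eventually : ∃ n₀ : ℕ, ∀ n ≥ n₀, ∀ s : ℕ, 2 * s + 1 < n →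
    ∃ D : MvPolynomial (degLEMonomials n) ℂ,
      IsNaturalProof (degLEMonomials n) {f : MvPolynomial (Fin n) ℂ | complexity f ≤ s}
        (Distinguishers ℂ n 1) D := by
  obtain ⟨n₀, hn₀⟩ := cones_level_one_eventually
  refine ⟨max n₀ 3, fun n hn s hs => isNaturalProof_cones (le_of_max_le_right hn) hs ?_⟩
  rw [pow_one]
  exact hn₀ n (le_of_max_le_left hn)

end DegreeWindow

end Summit.ValiantsHypothesis.ValiantsHypothesis.Theorems.BarrierLeverDefinableEquations
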